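/-
Copyright (c) 2026 the pub-hodgecm-mathlib formalisation cell (harness21).  Prover seat hodgecm-mathlib-B-p04 (g61), req618 STAGE 1a «FOUR-FRAME» squad, Track A TIER 2
for the tier-1 socket `U1_Frames` (assembler B-p04): the UP-STEP of A-2↓ (`stub_U1_exists_axisStable_vertex_dist_le`), BRICK 2 of 4.  2026-09-03.
-/
import Literature.NumberTheory.Automorphic.UnitaryThreeFourFrameAxisDescentSelfDual   -- ★ p854730 (B-p04): BRICK 1 (`pairing_frameProj_mulVec`, `smul_frameProj_mul_self`); brings ★ DefectModuleShape (`frameProj_mulVec`), Types ∕ Dual ∕ Framed ∕ PIR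
import Literature.NumberTheory.Automorphic.UnitaryLatticeTreeIsocelesRegionCriterionRamified   -- ★ `UnitaryLatticeTree.le_one_of_mul_self_le_one` (`a·a ≤ 1 ⇒ a ≤ 1` in `ℤᵐ⁰`)
import HarnessLib

/-!
# (D-RAM) «FOUR-FRAME» road, unit (i), TIER 2, BRICK 2: the UP-STEP of A-2↓ — from ANY vertex `M` with `ϖ^c·π·M ⊆ M^♯` to the vertex `L = M + (M^♯ ∩ Kf) ⊇ M`
# with `ϖ^c·π·L ⊆ L` (Kottwitz 1986 §1; Jacobowitz 1962 §7–§8; Bruhat–Tits 1972 §10)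

Topic `NumberTheory/Automorphic`; namespace `Literature.NumberTheory.Automorphic.UnitaryThreeFourFrame`.  THEOREMS ONLY; abstract currency (`K` any field with `Valued K ℤᵐ⁰`,
`σ` an isometric involution whose non-zero fixed elements have EVEN valuation — conjunct 4 of ★ `IsRamifiedQuadraticDatum` —, `ϖ` a uniformiser, `Φ₃ = (StdForm.antidiagonal 3).over K`,
`π = frameProj σ f`, `N(f) = ⟨f, f⟩ ≠ 0`).  Cell `pub/hodgecm-mathlib`, crux H413; tier-1 socket `U1_Frames` stub U1-2.  BRICK 1 = ★ `UnitaryThreeFourFrameAxisDescentSelfDual`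
(the descent step at a self-dual vertex); this BRICK 2 is the step used at a type-2 vertex once BRICK 3 supplies its hypothesis `ϖ^c·π·M ⊆ M^♯`; BRICK 4 is the induction.

THE MATHEMATICS.  Let `M` be a vertex (`ϖM^♯ ⊆ M ⊆ M^♯`, `M = latt g`) and `P := M^♯ ∩ Kf` (the axis part of the dual).  (§1) AXIS VECTORS PAIR INTEGRALLY: for `p = a·f ∈ M^♯`,
`⟨p, p⟩ = σa·a·N(f)` is `σ`-fixed, so of even valuation, and `|ϖ|·|⟨p,p⟩| = |⟨ϖp, p⟩| ≤ 1` (`ϖp ∈ ϖM^♯ ⊆ M`), whence `|⟨p, p⟩| ≤ 1`; and `|⟨p, p′⟩|² = |⟨p,p⟩|·|⟨p′,p′⟩|`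
for two axis vectors, so `⟨P, P⟩ ⊆ 𝒪`.  (§2) `L := M + P` is a VERTEX containing `M` and contained in `M^♯`: `⟨L, L⟩ ⊆ 𝒪` (the four cross terms), `ϖL^♯ ⊆ ϖM^♯ ⊆ M ⊆ L`,
and `L` is framed (squeezed between `latt g` and `M^♯ = latt ((σg)ᵀΦ₃)⁻¹` over the principal ring `𝒪`).  (§2) STABILITY: with `T = ϖ^c π`, `TM ⊆ M^♯ ∩ Kf = P` by hypothesis
(`πx ∈ Kf` always) and `Tp = ϖ^c p ∈ P` (`πf = f`), so `TL ⊆ L`.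

HONEST LABEL: HC_CM is proved only modulo the 7 printed citations (2 remaining named inputs: hLiu418 = stmt-HodgeConjecture-24832, h413 = stmt-HodgeConjecture-24833) until rung 0
closes; `--supports stmt-HodgeConjecture-24833` helper; elementary lattice algebra.
-/

noncomputable section

open scoped Valued WithZero Matrix MatrixGroups

namespace Literature.NumberTheory.Automorphic.UnitaryThreeFourFrame

open Literature.NumberTheory.Automorphic Literature.NumberTheory.Automorphic.HermitianLattice
  Literature.NumberTheory.Automorphic.UnitaryLatticeTree

variable {K : Type} [Field K] [Valued K ℤᵐ⁰]

/-! ## §1  Axis vectors of the dual pair integrally -/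

omit [Valued K ℤᵐ⁰] in
/-- `⟨a·f, a′·f⟩ = σa · (a′ · N(f))`. [cite: Jacobowitz1962, §4] -/
theorem pairing_smul_frame_smul_frame (σ : K →+* K) (f : Fin 3 → K) (a a' : K) :
    pairing σ ((StdForm.antidiagonal 3).over K) (a • f) (a' • f) = σ a * (a' * pairing σ ((StdForm.antidiagonal 3).over K) f f) := by
  rw [LinearMap.map_smulₛₗ₂, map_smul, smul_eq_mul, smul_eq_mul]

omit [Valued K ℤᵐ⁰] in
/-- `⟨a·f, a·f⟩` is `σ`-fixed (`N(f) = σN(f)` for the hermitian `Φ₃`). [cite: Jacobowitz1962, §4] -/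
theorem map_pairing_smul_frame_self {σ : K →+* K} (hσσ : ∀ a, σ (σ a) = a) (f : Fin 3 → K) (a : K) :
    σ (pairing σ ((StdForm.antidiagonal 3).over K) (a • f) (a • f)) = pairing σ ((StdForm.antidiagonal 3).over K) (a • f) (a • f) :=
  (pairing_comm_of_hermitian hσσ (map_antidiagonal_three_over_apply_eq σ) (a • f) (a • f)).symm

/-- In `ℤᵐ⁰ = WithZero (Multiplicative ℤ)`: an element of the form `exp (2n)` which is `≤ exp 1` is `≤ 1` (parity). [cite: Serre1979, Ch. V §3] -/
theorem exp_two_mul_le_one_of_le_exp_one {n : ℤ} (h : WithZero.exp (2 * n) ≤ (WithZero.exp (1 : ℤ) : ℤᵐ⁰)) : WithZero.exp (2 * n) ≤ (1 : ℤᵐ⁰) := by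
  rw [WithZero.exp_le_exp] at h
  rw [← WithZero.exp_zero, WithZero.exp_le_exp]
  omega

/-- **An axis vector of the dual of a vertex has integral norm**: `M` a vertex, `p = a·f ∈ M^♯` ⇒ `|⟨p, p⟩| ≤ 1` — `ϖp ∈ ϖM^♯ ⊆ M` gives `|ϖ|·|⟨p,p⟩| = |⟨ϖp, p⟩| ≤ 1`, and
`⟨p, p⟩` is `σ`-fixed, hence of EVEN valuation (ramified datum), so `|⟨p, p⟩| ≠ |ϖ|⁻¹`. [cite: Jacobowitz1962, §7–§8] [cite: Kottwitz1986BaseChangeUnits, §1 pp. 240–241] -/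
theorem v_pairing_self_le_one_of_smul_frame_mem_dualLatt {σ : K →+* K} (hσσ : ∀ a, σ (σ a) = a) (hvσ : ∀ a, Valued.v (σ a) = Valued.v a) {ϖ : K}
    (hϖ : Valued.v ϖ = WithZero.exp (-1 : ℤ)) (heven : ∀ x : K, σ x = x → x ≠ 0 → ∃ n : ℤ, Valued.v x = WithZero.exp (2 * n))
    {M : Submodule 𝒪[K] (Fin 3 → K)} {d : ℕ} (hM : IsVertexLattice σ ϖ ((StdForm.antidiagonal 3).over K) d M) (f : Fin 3 → K) {a : K}
    (hp : a • f ∈ dualLatt σ ((StdForm.antidiagonal 3).over K) M) :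
    Valued.v (pairing σ ((StdForm.antidiagonal 3).over K) (a • f) (a • f)) ≤ 1 := by
  have hϖ0 : ϖ ≠ 0 := fun h => by rw [h, map_zero] at hϖ; exact WithZero.zero_ne_coe hϖ
  have hH : IsUnit ((StdForm.antidiagonal 3).over K).det := isUnit_iff_ne_zero.2 fun h0 => by
    have h1 := v_det_antidiagonal_three (K := K); rw [h0, map_zero] at h1; exact zero_ne_one h1
  -- `ϖ p ∈ M`
  have hϖp : ϖ • (a • f) ∈ M := by
    refine scaleLattice_dualLatt_le_of_isVertexLattice hvσ hH hM ?_
    rw [mem_scaleLattice_iff hϖ0, smul_smul, inv_mul_cancel₀ hϖ0, one_smul]; exact hp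
  -- `|⟨ϖp, p⟩| ≤ 1`
  have h1 : Valued.v (pairing σ ((StdForm.antidiagonal 3).over K) (ϖ • (a • f)) (a • f)) ≤ 1 := (mem_dualLatt σ _ M _).1 hp _ hϖp
  rw [LinearMap.map_smulₛₗ₂, smul_eq_mul, map_mul, hvσ] at h1
  by_cases h0 : pairing σ ((StdForm.antidiagonal 3).over K) (a • f) (a • f) = 0
  · rw [h0, map_zero]; exact zero_le_one
  obtain ⟨n, hn⟩ := heven _ (map_pairing_smul_frame_self hσσ f a) h0
  rw [hn] at h1 ⊢
  refine exp_two_mul_le_one_of_le_exp_one ?_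
  rw [hϖ, ← WithZero.exp_add, ← WithZero.exp_zero, WithZero.exp_le_exp] at h1
  rw [WithZero.exp_le_exp]; omega

/-- **Two axis vectors of the dual of a vertex pair integrally**: `|⟨p, p′⟩|² = |⟨p, p⟩|·|⟨p′, p′⟩| ≤ 1`. [cite: Jacobowitz1962, §7–§8] -/
theorem v_pairing_le_one_of_smul_frame_mem_dualLatt {σ : K →+* K} (hσσ : ∀ a, σ (σ a) = a) (hvσ : ∀ a, Valued.v (σ a) = Valued.v a) {ϖ : K}
    (hϖ : Valued.v ϖ = WithZero.exp (-1 : ℤ)) (heven : ∀ x : K, σ x = x → x ≠ 0 → ∃ n : ℤ, Valued.v x = WithZero.exp (2 * n))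
    {M : Submodule 𝒪[K] (Fin 3 → K)} {d : ℕ} (hM : IsVertexLattice σ ϖ ((StdForm.antidiagonal 3).over K) d M) (f : Fin 3 → K) {a a' : K}
    (hp : a • f ∈ dualLatt σ ((StdForm.antidiagonal 3).over K) M) (hp' : a' • f ∈ dualLatt σ ((StdForm.antidiagonal 3).over K) M) :
    Valued.v (pairing σ ((StdForm.antidiagonal 3).over K) (a • f) (a' • f)) ≤ 1 := by
  have h1 := v_pairing_self_le_one_of_smul_frame_mem_dualLatt hσσ hvσ hϖ heven hM f hp
  have h2 := v_pairing_self_le_one_of_smul_frame_mem_dualLatt hσσ hvσ hϖ heven hM f hp'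
  rw [pairing_smul_frame_smul_frame, map_mul, map_mul, hvσ] at h1 h2 ⊢
  refine le_one_of_mul_self_le_one ?_
  calc Valued.v a * (Valued.v a' * Valued.v (pairing σ ((StdForm.antidiagonal 3).over K) f f)) *
        (Valued.v a * (Valued.v a' * Valued.v (pairing σ ((StdForm.antidiagonal 3).over K) f f)))
      = Valued.v a * (Valued.v a * Valued.v (pairing σ ((StdForm.antidiagonal 3).over K) f f)) *
        (Valued.v a' * (Valued.v a' * Valued.v (pairing σ ((StdForm.antidiagonal 3).over K) f f))) := by
          simp only [mul_comm, mul_left_comm]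
    _ ≤ 1 * 1 := mul_le_mul' h1 h2
    _ = 1 := mul_one 1

/-! ## §2  The up-step: `L = M + (M^♯ ∩ Kf)` -/

/-- **THE UP-STEP.**  `σ` an isometric involution with even-valued fixed elements, `ϖ` a uniformiser, `π = π_f` (`N(f) ≠ 0`), `M` a VERTEX of the lattice graph of `(K³, Φ₃)` with
`ϖ^c·π·M ⊆ M^♯`.  Then `L := M + (M^♯ ∩ Kf)` is a VERTEX with `M ⊆ L ⊆ M^♯` (so `L = M` or `L` is adjacent to `M`) and `ϖ^c·π·L ⊆ L`.
[cite: Kottwitz1986BaseChangeUnits, §1 pp. 240–241] [cite: Jacobowitz1962, §7–§8] [cite: BruhatTits1972, §10] -/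
theorem exists_axisStable_vertex_ge_of_map_le_dualLatt {σ : K →+* K} (hσσ : ∀ a, σ (σ a) = a) (hvσ : ∀ a, Valued.v (σ a) = Valued.v a) {ϖ : K}
    (hϖ : Valued.v ϖ = WithZero.exp (-1 : ℤ)) (heven : ∀ x : K, σ x = x → x ≠ 0 → ∃ n : ℤ, Valued.v x = WithZero.exp (2 * n))
    {f : Fin 3 → K} (hf : pairing σ ((StdForm.antidiagonal 3).over K) f f ≠ 0)
    {M : Submodule 𝒪[K] (Fin 3 → K)} (hM : IsVertex σ ϖ ((StdForm.antidiagonal 3).over K) M) {c : ℕ}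
    (h1 : M.map ((Matrix.toLin' (ϖ ^ c • frameProj σ f)).restrictScalars 𝒪[K]) ≤ dualLatt σ ((StdForm.antidiagonal 3).over K) M) :
    ∃ L : Submodule 𝒪[K] (Fin 3 → K), IsVertex σ ϖ ((StdForm.antidiagonal 3).over K) L ∧
      L.map ((Matrix.toLin' (ϖ ^ c • frameProj σ f)).restrictScalars 𝒪[K]) ≤ L ∧ M ≤ L ∧ L ≤ dualLatt σ ((StdForm.antidiagonal 3).over K) M := by
  classical
  obtain ⟨d, hMd⟩ := hM
  have hϖ0 : ϖ ≠ 0 := fun h => by rw [h, map_zero] at hϖ; exact WithZero.zero_ne_coe hϖ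
  have hvϖ0 : Valued.v ϖ ≠ 0 := (Valuation.ne_zero_iff _).2 hϖ0
  have hϖ1 : Valued.v ϖ ≤ 1 := by rw [hϖ, ← WithZero.exp_zero, WithZero.exp_le_exp]; omega
  have hH : IsUnit ((StdForm.antidiagonal 3).over K).det := isUnit_iff_ne_zero.2 fun h0 => by
    have h1 := v_det_antidiagonal_three (K := K); rw [h0, map_zero] at h1; exact zero_ne_one h1
  have hJ := map_antidiagonal_three_over_apply_eq (K := K) σ
  set T : Matrix (Fin 3) (Fin 3) K := ϖ ^ c • frameProj σ f with hT_def
  set φ : (Fin 3 → K) →ₗ[𝒪[K]] (Fin 3 → K) := (Matrix.toLin' T).restrictScalars 𝒪[K] with hφ_def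
  have hφ : ∀ x, φ x = T *ᵥ x := fun x => rfl
  -- the axis part of the dual and the up-step lattice
  set P : Submodule 𝒪[K] (Fin 3 → K) :=
    dualLatt σ ((StdForm.antidiagonal 3).over K) M ⊓ (Submodule.span K {f}).restrictScalars 𝒪[K] with hP_def
  have hmemP : ∀ x, x ∈ P ↔ x ∈ dualLatt σ ((StdForm.antidiagonal 3).over K) M ∧ ∃ a : K, a • f = x := fun x => by
    rw [hP_def, Submodule.mem_inf, Submodule.restrictScalars_mem, Submodule.mem_span_singleton]
  set L : Submodule 𝒪[K] (Fin 3 → K) := M ⊔ P with hL_def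
  have hML : M ≤ L := le_sup_left
  have hPL : P ≤ L := le_sup_right
  have hMdual : M ≤ dualLatt σ ((StdForm.antidiagonal 3).over K) M := le_dualLatt_of_isVertexLattice hvσ hMd
  have hLD : L ≤ dualLatt σ ((StdForm.antidiagonal 3).over K) M := sup_le hMdual inf_le_left
  -- (i) `⟨L, L⟩ ⊆ 𝒪`
  have hLint : L ≤ dualLatt σ ((StdForm.antidiagonal 3).over K) L := by
    intro y hy
    rw [mem_dualLatt]
    intro x hx
    obtain ⟨m, hm, p, hp, rfl⟩ := Submodule.mem_sup.1 hx
    obtain ⟨m', hm', p', hp', rfl⟩ := Submodule.mem_sup.1 hy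
    obtain ⟨hpD, a, rfl⟩ := (hmemP p).1 hp
    obtain ⟨hp'D, a', rfl⟩ := (hmemP p').1 hp'
    rw [map_add, LinearMap.map_add₂, LinearMap.map_add₂]
    refine Valuation.map_add_le _ (Valuation.map_add_le _ ?_ ?_) (Valuation.map_add_le _ ?_ ?_)
    · exact (mem_dualLatt σ _ M _).1 (hMdual hm') m hm
    · rw [v_pairing_comm_of_hermitian hvσ hσσ hJ]; exact (mem_dualLatt σ _ M _).1 hpD m' hm'
    · exact (mem_dualLatt σ _ M _).1 hp'D m hm
    · exact v_pairing_le_one_of_smul_frame_mem_dualLatt hσσ hvσ hϖ heven hMd f hpD hp'D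
  -- (ii) `ϖL^♯ ⊆ L`
  have hϖL : scaleLattice ϖ (dualLatt σ ((StdForm.antidiagonal 3).over K) L) ≤ L :=
    ((scaleLattice_mono ϖ (dualLatt_antitone σ _ hML)).trans (scaleLattice_dualLatt_le_of_isVertexLattice hvσ hH hMd)).trans hML
  -- (iii) `L` is framed
  obtain ⟨g, hMg, -, -, -⟩ := id hMd
  haveI := Literature.RingTheory.DiscreteValuationRing.isPrincipalIdealRing_valuedInteger (K := K)
  have hgdet : IsUnit (g : Matrix (Fin 3) (Fin 3) K).det := Matrix.isUnits_det_units g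
  have hBdet : ((((g : Matrix (Fin 3) (Fin 3) K).map σ)ᵀ * (StdForm.antidiagonal 3).over K)⁻¹).det ≠ 0 :=
    (Matrix.isUnit_nonsing_inv_det_iff.2 (by rw [Matrix.det_mul]; exact (isUnit_det_transpose_map σ hgdet).mul hH)).ne_zero
  obtain ⟨g', hLg'⟩ := exists_eq_latt_of_latt_le_of_le_latt g (Matrix.GeneralLinearGroup.mkOfDetNeZero _ hBdet) L
    (by rw [← hMg]; exact hML) (by rw [Matrix.GeneralLinearGroup.val_mkOfDetNeZero, ← dualLatt_latt_eq σ hvσ hH hgdet, ← hMg]; exact hLD)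
  -- (iv) `L` is a vertex
  have hg'det : IsUnit (g' : Matrix (Fin 3) (Fin 3) K).det := Matrix.isUnits_det_units g'
  have hint : IsIntMatrix (formCongr σ g' ((StdForm.antidiagonal 3).over K)) := by
    have h := hLint; rw [hLg'] at h
    exact (latt_le_dualLatt_latt_iff σ hvσ _ _).1 h
  have hint' : IsIntMatrix (ϖ • (formCongr σ g' ((StdForm.antidiagonal 3).over K))⁻¹) := by
    have h := hϖL; rw [hLg'] at h
    exact (scaleLattice_dualLatt_latt_le_iff σ hvσ hH hg'det ϖ).1 h
  have hGdet : (formCongr σ g' ((StdForm.antidiagonal 3).over K)).det ≠ 0 := by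
    rw [formCongr, Matrix.det_mul, Matrix.det_mul]
    exact mul_ne_zero (mul_ne_zero (isUnit_det_transpose_map σ hg'det).ne_zero hH.ne_zero) hg'det.ne_zero
  have hvG : Valued.v (formCongr σ g' ((StdForm.antidiagonal 3).over K)).det ≤ 1 :=
    Literature.NumberTheory.Automorphic.CartanUnique.v_det_le_one_of_forall_v_le_one hint
  have hGdet0 : Valued.v (formCongr σ g' ((StdForm.antidiagonal 3).over K)).det ≠ 0 := (Valuation.ne_zero_iff _).2 hGdet
  obtain ⟨k, hk⟩ : ∃ k : ℕ, Valued.v (formCongr σ g' ((StdForm.antidiagonal 3).over K)).det = Valued.v ϖ ^ k := by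
    refine ⟨(-WithZero.log (Valued.v (formCongr σ g' ((StdForm.antidiagonal 3).over K)).det)).toNat, ?_⟩
    have hm0 : WithZero.log (Valued.v (formCongr σ g' ((StdForm.antidiagonal 3).over K)).det) ≤ 0 := by
      rw [WithZero.log_le_iff_le_exp hGdet0, WithZero.exp_zero]; exact hvG
    rw [hϖ, ← WithZero.exp_nsmul, nsmul_eq_mul, Int.toNat_of_nonneg (by omega), mul_neg, mul_one, neg_neg, WithZero.exp_log hGdet0]
  -- (v) `T L ⊆ L`
  have hπf : frameProj σ f *ᵥ f = f := by rw [frameProj_mulVec, inv_mul_cancel₀ hf, one_smul]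
  have hTL : L.map φ ≤ L := by
    rintro _ ⟨x, hx, rfl⟩
    obtain ⟨m, hm, p, hp, rfl⟩ := Submodule.mem_sup.1 hx
    obtain ⟨hpD, a, rfl⟩ := (hmemP p).1 hp
    rw [hφ, Matrix.mulVec_add]
    refine hPL (P.add_mem ?_ ?_)
    · -- `T m ∈ M^♯ ∩ Kf`
      refine (hmemP _).2 ⟨h1 ⟨m, hm, rfl⟩, ϖ ^ c * ((pairing σ ((StdForm.antidiagonal 3).over K) f f)⁻¹ * pairing σ ((StdForm.antidiagonal 3).over K) f m), ?_⟩
      rw [hT_def, Matrix.smul_mulVec, frameProj_mulVec, smul_smul]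
    · -- `T p = ϖ^c p ∈ M^♯ ∩ Kf`
      have hTp : T *ᵥ (a • f) = ϖ ^ c • (a • f) := by rw [hT_def, Matrix.smul_mulVec, Matrix.mulVec_smul, hπf]
      rw [hTp]
      refine (hmemP _).2 ⟨smul_mem_of_v_le _ (by rw [map_pow]; exact pow_le_one₀ zero_le hϖ1) hpD, ϖ ^ c * a, ?_⟩
      rw [smul_smul]
  exact ⟨L, ⟨k, g', hLg', hint, hint', hk⟩, hTL, hML, hLD⟩

end Literature.NumberTheory.Automorphic.UnitaryThreeFourFrame
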